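import Literature.AnabelianGeometry.EtaleTheta.ThetaCoversMonodromyModelAut
import HarnessLib

/-!
# The MONODROMY MODEL of [EtTh] §2, part 5: the sheet coordinate `e` — the parametrisation
# `(ℤ/l × D_∞) × ℤ/2 ↪ TG l` of `Π^tp_{C̲}` and the rotation-parity character of `D_∞`

S. Mochizuki, *The étale theta function and its Frobenioid-theoretic manifestations* [EtTh], Publ. RIMS **45**
(2009), §2 Prop. 2.4 (PDF p. 38), Rmk. 2.6.1 (p. 40: the `Aut_K` of the dotted curves are the direct products of the
undotted ones with `Gal(Ċ/C) ≅ {±1}`) [cite: MochizukiEtTh2009, Rmk 2.6.1 p.40].  Cell abc-iut, layer L2, seat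
abc-iut-w6-d084 (gen 7), «P26-NV MONODROMY TOY» STAGE 2b (typed Prop. 2.4 at the model; abc-iut-L2-lead R1352).
DEF-BEARING (class (b) MODEL/CONSTRUCTION; no frozen structure touched).  Sequel of `ThetaCoversMonodromyModelAut.lean`.

HONEST LABEL (R1352): a DESIGNED tempered toy with print's monodromy combinatorics; `G_K := 1`; NOT a Tate curve, NOT the
tempered fundamental group of a curve; consistency ≠ faithfulness; nothing here takes a side on anything printed.

CONTENT.  `embCuE : (ℤ/l × D_∞) × ℤ/2 ↪ TG l`, `((c, d), e) ↦ ((0, c), d, e)` — its image is the UNDOTTED member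
`Π^tp_{C̲} = {b = 0}` and it restricts to `Π^tp_{C̲̲} ≅ D_∞ × ℤ/2`, `Π^tp_{X̲} ≅ (ℤ/l × ℤ) × ℤ/2`, `Π^tp_{X̲̲} ≅ ℤ × ℤ/2`
(the undotted members are the dotted ones times the sheet `⟨e⟩` of `Ÿ → Y`); `rotParity : D_∞ → ℤ/2`
(`r^i, s r^i ↦ i mod 2`), the character by which the loop `t` twists the sheet (`sheetTwist (rotParity ∘ pr)` is
`t ↦ e t`).
-/

noncomputable section

namespace Literature.AnabelianGeometry.EtaleTheta.ThetaCovers.MonodromyModel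

open Multiplicative HeisenbergWitness TemperedModel DihedralGroup

variable (l : ℕ)

/-- **`embCuE : (ℤ/l × D_∞) × ℤ/2 ↪ TG l`, `((c, d), e) ↦ ((0, c), d, e)`** (onto `Π^tp_{C̲} = {b = 0}`). (toy bookkeeping
for [EtTh] Rmk. 2.6.1 «× Gal(Ċ/C)»; no claim about print) [cite: MochizukiEtTh2009, Rmk 2.6.1 p.40] -/
def embCuE : (Multiplicative (ZMod l) × DihedralGroup 0) × Multiplicative (ZMod 2) →* TG l :=
  ((TG.fst l).comp (embCu l)).prodMap (MonoidHom.id (Multiplicative (ZMod 2)))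

/-- Coordinates of `embCuE`. (toy bookkeeping) [cite: MochizukiEtTh2009, Rmk 2.6.1 p.40] -/
@[simp] theorem embCuE_coords (q : (Multiplicative (ZMod l) × DihedralGroup 0) × Multiplicative (ZMod 2)) :
    (embCuE l q).1.right = q.1.2 ∧ bC l (embCuE l q) = 0 ∧ cC l (embCuE l q) = toAdd q.1.1 ∧ (embCuE l q).2 = q.2 :=
  ⟨rfl, rfl, rfl, rfl⟩

/-- `embCuE (p, 1) = embCu p`. (toy bookkeeping) [cite: MochizukiEtTh2009, Rmk 2.6.1 p.40] -/
theorem embCuE_one (p : Multiplicative (ZMod l) × DihedralGroup 0) : embCuE l (p, 1) = embCu l p := rfl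

/-- `embCuE` is injective. (toy bookkeeping) [cite: MochizukiEtTh2009, Rmk 2.6.1 p.40] -/
theorem embCuE_injective : Function.Injective (embCuE l) := by
  intro p q h
  refine Prod.ext (Prod.ext (toAdd.injective ?_) ?_) ?_
  · rw [← (embCuE_coords l p).2.2.1, ← (embCuE_coords l q).2.2.1, h]
  · rw [← (embCuE_coords l p).1, ← (embCuE_coords l q).1, h]
  · rw [← (embCuE_coords l p).2.2.2, ← (embCuE_coords l q).2.2.2, h]

/-- An element with `b = 0` is `embCuE ((c, d), e)`. (toy bookkeeping for [EtTh] Rmk. 2.6.1; no claim about print)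
[cite: MochizukiEtTh2009, Rmk 2.6.1 p.40] -/
theorem eq_embCuE_of_bC {g : TG l} (hb : bC l g = 0) : g = embCuE l ((ofAdd (cC l g), g.1.right), g.2) :=
  TG.ext l rfl (by rw [(embCuE_coords l _).2.1, hb]) (by rw [(embCuE_coords l _).2.2.1, toAdd_ofAdd]) rfl

/-- **The rotation-parity character `D_∞ → ℤ/2`**: `r^i ↦ i mod 2`, `s r^i ↦ i mod 2` (well defined since `−1 = 1` in
`ℤ/2`). (toy bookkeeping for [EtTh] Rmk. 2.6.1; classical, no claim about print) [cite: MochizukiEtTh2009, Rmk 2.6.1 p.40] -/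
def rotParity : DihedralGroup 0 →* Multiplicative (ZMod 2) where
  toFun d := match d with
    | DihedralGroup.r i => ofAdd (ZMod.castHom (dvd_zero 2) (ZMod 2) i)
    | DihedralGroup.sr i => ofAdd (ZMod.castHom (dvd_zero 2) (ZMod 2) i)
  map_one' := by rw [one_def]; simp
  map_mul' g h := by
    have hneg : ∀ x : ZMod 2, -x = x := by decide
    rcases g with i | i <;> rcases h with j | j
    · simp only [r_mul_r, map_add, ofAdd_add]
    · simp only [r_mul_sr]
      rw [map_sub, sub_eq_add_neg, hneg, add_comm, ofAdd_add]
    · simp only [sr_mul_r, map_add, ofAdd_add]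
    · simp only [sr_mul_sr]
      rw [map_sub, sub_eq_add_neg, hneg, add_comm, ofAdd_add]

/-- `rotParity (r i) = i mod 2`. (toy bookkeeping) [cite: MochizukiEtTh2009, Rmk 2.6.1 p.40] -/
@[simp] theorem rotParity_r (i : ZMod 0) : rotParity (r i) = ofAdd (ZMod.castHom (dvd_zero 2) (ZMod 2) i) := rfl

/-- `rotParity (s r^i) = i mod 2`. (toy bookkeeping) [cite: MochizukiEtTh2009, Rmk 2.6.1 p.40] -/
@[simp] theorem rotParity_sr (i : ZMod 0) : rotParity (sr i) = ofAdd (ZMod.castHom (dvd_zero 2) (ZMod 2) i) := rfl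

end Literature.AnabelianGeometry.EtaleTheta.ThetaCovers.MonodromyModel

end
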